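import Summits.ABC.IUTFork.Cor312PilotIdelesPrCapstone
import HarnessLib

/-!
# [IUTchIII] Corollary 3.12 — PROVENANCE `IsSettingOf D P` at the print-normalised assembled real setting with pilot
# regions read off ideles: the `q`-number field DISCHARGED, the index bookkeeping made an explicit binder

PROOF-ONLY record file (D-0012; no definitions) of the abc-iut cell (Cor. 3.12 sub-crew, seat abc-iut-c312-7, gen 3;
D-0067 TEAM A row A-0 coda «A-0 AT THE PRINT-NORMALISED SETTING»); TAKES NO SIDE. plan/ADJUDICATION-SPEC §1 names the
conclusion of record as the verbatim `Cor312.Setting.Statement` "AT the assembled real setting … tied to initial Θ-data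
by `Cor312Prov.IsSettingOf D P`" (abc-iut-c312-8, `Cor312Provenance.lean`: fields `lstar_eq`, `places`, `VFbad_finite`,
`negLogQ_eq : P.negLogQ = −absLogq D`). For the real-container settings of record two of the four fields are NOT free:

* `negLogQ_eq` is the `q`-NUMBER identity. At abc-iut-c312-1's PRINT-NORMALISED setting with abc-iut-c312-3's `q`-centre
  read off ideles realising `P_q` it is this seat's THEOREM `negLogQ_settingPrVol_eq_neg_absLogq` (p423787, under
  abc-iut-c312-8's `IsPilotDataOf D X`). (At the constant-weighted `Real.settingDHVol(Sharp)` the verbatim `negLogQ` is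
  instead the `j`-twisted sum of abc-iut-c312-1's finding F-c312-1-g5-1 — kernel certificate `Real.logvol_p_mul_DH` — so a
  binder `(hS : IsSettingOf D (settingDHVolSharp …))` is met only by numerical coincidence unless every prime under `S` is
  totally split in `F`; recorded here as a CAVEAT for the provenance-form sentences at that container, no theorem.)
* `places : ∃ e : 𝕍(F)… ≃ V̲, bad ↔ bad` is INDEX BOOKKEEPING between the Dupuy–Hilado-level index `Place F` of the pilot
  datum `X` (abc-iut-c312-5 `thetaIndex X`) and [IUTchI] Def. 3.1 (e)'s section `V̲ ⊆ 𝕍(K)` (`D.V ≅ 𝕍_mod`): such a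
  bijection exists iff `|S| = |V̲^bad| (= |𝕍^bad_mod|)` — i.e. iff no bad place of `F_mod` has two places of `F` above it
  (`S = 𝕍(F)^bad := 𝕍^bad_mod ×_{𝕍_mod} 𝕍(F)` under `IsPilotDataOf`) —; it is kept as the ONE explicit binder `hplaces`
  below (abc-iut-c312-8's `Cor312ProvenanceReal` avoids it by working over `thetaIndexOfInitial D`, whose real
  CONTAINERS are not assembled in the tree; abc-iut-w4-d026's `Cor312NaiveProv*` supplies provenance there with the
  natural glue).

THIS file: **`isSettingOf_settingPrVol_qCentreDH`** (any Θ-box binder) and **`isSettingOf_settingPrVolSharp`** —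
`IsSettingOf D P` for the print-normalised assembled real setting from {`IsPilotDataOf D X`, `q`-ideles realising `P_q`,
`hplaces`}: `lstar_eq` from `IsPilotDataOf.l_eq` (`(thetaIndex X).lstar = (X.l − 1)/2`), `VFbad_finite` = abc-iut-c312-8's
`vFbad_finite D`, `negLogQ_eq` = p423787; and the corollaries through abc-iut-c312-8's `IsSettingOf` API
(`absLogQPos_of`, the numbers-of-record `numbersOf_cor312_iff`). [claim: Mochizuki2012, status: disputed] for the quoted
setting; [cite: Mochizuki2012, IUTchI Def. 3.1 (e) p. 61, IUTchIV Thm. 1.10 p. 23]; [cite: DupuyHilado2025, §3.3, §3.4].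
HONEST FRAMING: bookkeeping; `hplaces` is a genuine restriction on `(D, X)`, named, not assumed away; nothing here bears
on the truth of Cor. 3.12. typed ≠ proved; instantiated ≠ endorsed.
-/

noncomputable section

open Set Function NumberField IsDedekindDomain
open scoped Pointwise

namespace Summit.ABC

namespace IUTFork

namespace Thm311

namespace Real

open Cor312 Cor312Vol Cor312Prov Literature.IUT.LogThetaLattice Literature.IUT.LogVolume Literature.IUT.HodgeTheaters

variable {F : Type} [Field F] [NumberField F] (X : PilotData F) {logv : PadicLogs F} (hlog : LogvAnalytic logv)
  (M : Type) [Field M] [NumberField M]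
  (archPk : ∀ (j : (thetaIndex X).Label) (vQ : (thetaIndex X).VQ), Set ((logShellsDH X logv).Packet j vQ))
  (archSub : ∀ (j : (thetaIndex X).Label) (v : (thetaIndex X).V),
    Set ((logShellsDH X logv).Packet j ((thetaIndex X).over v)))
  (Ψ : ℤ → ∀ v : (thetaIndex X).V, v ∈ (thetaIndex X).Vbad → Set ((logShellsDH X logv).StarPacket v))
  (act : ℤ → ∀ v : (thetaIndex X).V, v ∈ (thetaIndex X).Vbad →
    (logShellsDH X logv).StarPacket v → Module.End ℚ ((logShellsDH X logv).StarPacket v))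
  (Mmod : ℤ → ∀ j : (thetaIndex X).LabelStar, Set ((logShellsDH X logv).GlobalPacket j.1))
  (region : ℤ → ∀ j : (thetaIndex X).LabelStar, FinDivisor M → ∀ vQ : (thetaIndex X).VQ,
    Set ((logShellsDH X logv).Packet j.1 vQ))
  (n : ℤ) {HT : Type} {LogLink : HT → HT → Type} {IsFull : ∀ {s t : HT}, LogLink s t → Prop}
  (lat : LGPGaussianLogThetaLattice LogLink IsFull)
  {Frd : Type} {IsoF : Frd → Frd → Type} {Ob : Frd → Type} {realify : Frd → Frd} {Strip : Type}
  {IsoS : Strip → Strip → Type} {Mv : ∀ v : (thetaIndex X).V, v ∈ (thetaIndex X).Vbad → Type}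
  [∀ v h, Monoid (Mv v h)]
  (sig : GlobalLGPFrobenioidSignature (thetaIndex X).lstar (thetaIndex X).V (· ∈ (thetaIndex X).Vbad)
    Frd IsoF Ob realify Strip IsoS Mv)
  (split : SplittingMonoids Mv) {ObΔ : Type} {N : ∀ v : (thetaIndex X).V, v ∈ (thetaIndex X).Vbad → Type}
  [∀ v h, Monoid (N v h)] (qData : QPilotData ObΔ N)
  (tq : ∀ (pp : Nat.Primes) (x : (thetaIndex X).Fibre (.inr pp)), haveI : Fact (pp : ℕ).Prime := ⟨pp.2⟩; kOf X pp.1 x)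
  (htq0 : ∀ pp x, tq pp x ≠ 0)
  /- the `q`-ideles REALISE `P_q` in Dupuy–Hilado's normalisation (3.4) -/
  (htq : ∀ (pp : Nat.Primes) (x : (thetaIndex X).Fibre (.inr pp)),
    haveI : Fact (pp : ℕ).Prime := ⟨pp.2⟩
    Real.log ‖tq pp x‖ = -(X.qPilot (placeOf X pp.1 x)) * logNorm F (placeOf X pp.1 x) /
      localDegree F (placeOf X pp.1 x))
  {K Fbar : Type} [Field K] [NumberField K] [Algebra F K] [Field Fbar] [Algebra F Fbar] [Algebra K Fbar]
  {E : WeierstrassCurve F} [E.IsElliptic] {l : ℕ} {Pb : BadPlacePredicates K} {D : InitialThetaData F K Fbar E l Pb}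

/-- The label count of the pilot datum's index skeleton is `(l − 1)/2` under the provenance link (`X.l = l`;
abc-iut-c312-3 `PilotData.lstar := (l − 1)/2`). [cite: DupuyHilado2025, §3.3] -/
theorem lstar_thetaIndex_eq_of_isPilotDataOf (hX : IsPilotDataOf D X) : (thetaIndex X).lstar = (l - 1) / 2 := by
  show X.lstar = (l - 1) / 2
  rw [PilotData.lstar, hX.l_eq]

include htq in
/-- **`IsSettingOf D P` for the print-normalised assembled real setting with the `q`-centre read off ideles realising
`P_q`** (ANY Θ-box binder), from the provenance link `IsPilotDataOf D X` and the index bijection `hplaces`: the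
`q`-number field is this seat's `negLogQ_settingPrVol_eq_neg_absLogq`, the label count is `IsPilotDataOf.l_eq`,
`𝕍(F)^bad` finite is abc-iut-c312-8's `vFbad_finite`. [claim: Mochizuki2012, status: disputed] -/
theorem isSettingOf_settingPrVol_qCentreDH (hX : IsPilotDataOf D X)
    (hplaces : ∃ e : (thetaIndex X).V ≃ D.V, ∀ v : (thetaIndex X).V,
      v ∈ (thetaIndex X).Vbad ↔ ((e v : D.V) : Val K) ∈ D.Vbad)
    (thetaBox : ℤ → Ob sig.Clgp → ∀ (j : (thetaIndex X).Label) (vQ : (thetaIndex X).VQ),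
      Set (∀ s : factorIdxDH X hlog j vQ, factorFieldDH X hlog j vQ s))
    (hfin : ∀ j : (thetaIndex X).Label, (Function.support fun vQ =>
      ((situationPrVol X hlog M archPk archSub Ψ act Mmod region).D n).logvol j vQ
        (factorMapDH X hlog j vQ ⁻¹' hullSet (factorFieldDH X hlog j vQ) (qCentreDH X hlog tq j vQ))).Finite) :
    IsSettingOf D (settingPrVol X hlog M archPk archSub Ψ act Mmod region n lat sig split qData thetaBox
      (fun _ => qCentreDH X hlog tq) (fun j vQ s => qCentreDH_ne_zero X hlog tq htq0 j vQ s) hfin) where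
  lstar_eq := lstar_thetaIndex_eq_of_isPilotDataOf X hX
  places := hplaces
  VFbad_finite := vFbad_finite D
  negLogQ_eq := negLogQ_settingPrVol_eq_neg_absLogq X hlog M archPk archSub Ψ act Mmod region n lat sig split qData
    thetaBox tq htq0 hfin htq hX

include htq in
/-- **`IsSettingOf D P` for `settingPrVolSharp`** (sharp Dupuy–Hilado Θ-boxes and `q`-centre from ideles; `tq` units off
`S` — a consequence of realising `P_q`, `Cor312PilotIdelesPrWitness.qIdele_norm_eq_one_of_realises`), from
`IsPilotDataOf D X` and `hplaces`. So plan/ADJUDICATION-SPEC §1's «assembled real setting tied to initial Θ-data by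
`IsSettingOf`» IS INHABITED at the print-normalised container whenever the index bijection exists (`|S| = |𝕍^bad_mod|`).
[claim: Mochizuki2012, status: disputed] -/
theorem isSettingOf_settingPrVolSharp (hX : IsPilotDataOf D X)
    (hplaces : ∃ e : (thetaIndex X).V ≃ D.V, ∀ v : (thetaIndex X).V,
      v ∈ (thetaIndex X).Vbad ↔ ((e v : D.V) : Val K) ∈ D.Vbad)
    (t : ∀ (pp : Nat.Primes) (_ : Fin X.lstar) (x : (thetaIndex X).Fibre (.inr pp)),
      haveI : Fact (pp : ℕ).Prime := ⟨pp.2⟩; kOf X pp.1 x)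
    (htq1 : ∀ (pp : Nat.Primes) (x : (thetaIndex X).Fibre (.inr pp)),
      haveI : Fact (pp : ℕ).Prime := ⟨pp.2⟩; placeOf X pp.1 x ∉ X.S → ‖tq pp x‖ = 1) :
    IsSettingOf D (settingPrVolSharp X hlog M archPk archSub Ψ act Mmod region n lat sig split qData tq t htq0 htq1) :=
  isSettingOf_settingPrVol_qCentreDH X hlog M archPk archSub Ψ act Mmod region n lat sig split qData tq htq0 htq hX hplaces
    _ _

include htq in
/-- Through abc-iut-c312-8's provenance API: "`|log(q)| > 0`" at `settingPrVolSharp` as `Cor312Prov.absLogQPos_of`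
(agrees with this seat's direct `absLogQPos_settingPrVolSharp`). [claim: Mochizuki2012, status: disputed] -/
theorem absLogQPos_settingPrVolSharp_of_isPilotDataOf (hX : IsPilotDataOf D X)
    (hplaces : ∃ e : (thetaIndex X).V ≃ D.V, ∀ v : (thetaIndex X).V,
      v ∈ (thetaIndex X).Vbad ↔ ((e v : D.V) : Val K) ∈ D.Vbad)
    (t : ∀ (pp : Nat.Primes) (_ : Fin X.lstar) (x : (thetaIndex X).Fibre (.inr pp)),
      haveI : Fact (pp : ℕ).Prime := ⟨pp.2⟩; kOf X pp.1 x)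
    (htq1 : ∀ (pp : Nat.Primes) (x : (thetaIndex X).Fibre (.inr pp)),
      haveI : Fact (pp : ℕ).Prime := ⟨pp.2⟩; placeOf X pp.1 x ∉ X.S → ‖tq pp x‖ = 1) :
    (settingPrVolSharp X hlog M archPk archSub Ψ act Mmod region n lat sig split qData tq t htq0 htq1).AbsLogQPos :=
  absLogQPos_of (isSettingOf_settingPrVolSharp X hlog M archPk archSub Ψ act Mmod region n lat sig split qData tq htq0 htq
    hX hplaces t htq1) hX

end Real

end Thm311

end IUTFork

end Summit.ABC

end
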